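import Summits.ResolutionOfSingularities.ResolutionOfSingularities.Theorems.WildQuotientsSummitReductionStubPairOrbitBlowupCentreNewChart
import HarnessLib

/-!
# `WildQuotients.SummitReduction` (stmt-ResolutionOfSingularities-16324), line `FramePerfect`, skeleton v8:
# helper lemmas for stub `stub_pair_orbitBlowupCentreNew` (C3) — the base-compatible formal model of
# the blown-up curve at the new singular point (de Jong 1996, 3.4, chart "`t₁ ≠ 0`", any field)

Route `ResolutionOfSingularities/WildQuotients`, crux `SummitReduction`; worker file supporting the
registered stub `stub_pair_orbitBlowupCentreNew` of the line skeleton (v8, lead c4).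

The any-field form of the tree's `DeJong1996.SemiStablePair.exists_blowupModel_codimTwo`
(`AlterationsSemiStableCodimTwoThicknessDrop.lean`): "Chart "`t₁ ≠ 0`". — Here we get
`A[u, v, u', v']/(u - t₁u', v - t₁v', u'v' - t₁^{n₁-2} t₂^{n₂} ⋯ t_r^{n_r})`" (de Jong 1996, 3.4,
p. 64). Given a blow-up `π : X' ⟶ X` of an ideal sheaf whose stalk at `π x'₁` completes, in a
base-compatible model `e₁ : 𝒪̂_{X,π x'₁} ≅ Â⟦u, v⟧/(uv - ∏ ŵᵢ^{νᵢ})` over `Â = 𝒪̂_{Y,f(π x'₁)}`, to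
`(u, v, ŵ_{i₀})` with `ν_{i₀} ≥ 2`, a point `x'₁` at which `X'` is singular, every germ at `x'₁` being a
germ of `𝒪_Y` modulo `𝔪` (the residue hypothesis of `centreNew_exists_chartMap`), and
`dim 𝒪̂_{X',x'₁} = m + 1`: `𝒪̂_{X',x'₁} ≅ Â⟦u', v'⟧/(u'v' - ŵ_{i₀}^{ν_{i₀}-2} ∏_{i ≠ i₀} ŵᵢ^{νᵢ})` over `Â`
(`centreNew_exists_blowupModel`: the chart computation `NodeDeformationRing.charts_of_base` of
`NodalBlowupFormalChartsCodimTwo.lean`; at the other points of the exceptional conic the complete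
local ring is a quotient of a regular ring of the same dimension).
-/

set_option linter.dupNamespace false

noncomputable section

open CategoryTheory CategoryTheory.Limits AlgebraicGeometry TopologicalSpace Topology
open Literature.AlgebraicGeometry.Resolution
open Literature.AlgebraicGeometry
open IsLocalRing Scheme.IdealSheafData DeJong1996 DeJong1996.FormalNodeRing NodalDeformation

namespace Summit.ResolutionOfSingularities.ResolutionOfSingularities.Theorems

universe u

set_option maxHeartbeats 1600000 in
/-- **The completed local ring of the blown-up scheme at a SINGULAR point over the centre is
`Â⟦u', v'⟧/(u'v' - ŵ_{i₀}^{ν_{i₀}-2} ∏_{i ≠ i₀} ŵᵢ^{νᵢ})` over `Â`** (de Jong 1996, 3.4, chart "`t₁ ≠ 0`",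
any field; the tree's `exists_blowupModel_codimTwo` with the base model, the residue hypothesis and
the dimension as explicit inputs). See the module docstring. [cite: DeJong1996, 3.4, p. 64] -/
theorem centreNew_exists_blowupModel {X X' Y : Scheme.{u}} [IsIntegral X'] [IsNoetherian X]
    [IsLocallyNoetherian X'] [IsLocallyNoetherian Y] (f : X ⟶ Y) {π : X' ⟶ X}
    (PT : X.IdealSheafData) (hπ : IsBlowup π PT) {x'₁ : X'}
    {Pst : Ideal (X.presheaf.stalk (π x'₁))} (hPTstalk : stalkIdeal PT (π x'₁) = Pst)
    {K : Type u} [Field K] {m : ℕ} (w : Fin m → Y.presheaf.stalk (f (π x'₁))) (ν : Fin m → ℕ)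
    (i₀ : Fin m) (hν2 : 2 ≤ ν i₀) (hwm : ∀ i, w i ∈ maximalIdeal (Y.presheaf.stalk (f (π x'₁))))
    (ι : Cpl (Y.presheaf.stalk (f (π x'₁))) ≃+* MvPowerSeries (Fin m) K)
    (hι : ∀ i, ι (AdicCompletion.of (maximalIdeal (Y.presheaf.stalk (f (π x'₁)))) _ (w i)) =
      MvPowerSeries.X i)
    (e₁ : Cpl (X.presheaf.stalk (π x'₁)) ≃+*
      NodeDeformationRing (Cpl (Y.presheaf.stalk (f (π x'₁))))
        (∏ i, AdicCompletion.of (maximalIdeal (Y.presheaf.stalk (f (π x'₁)))) _ (w i) ^ ν i))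
    (he₁ : ∀ a : Y.presheaf.stalk (f (π x'₁)),
      e₁ (algebraMap (X.presheaf.stalk (π x'₁)) (Cpl (X.presheaf.stalk (π x'₁)))
        ((f.stalkMap (π x'₁)).hom a)) =
        NodeDeformationRing.ofBase _ _
          (AdicCompletion.of (maximalIdeal (Y.presheaf.stalk (f (π x'₁)))) _ a))
    (hΛcentre : (Pst.map (algebraMap (X.presheaf.stalk (π x'₁)) (Cpl (X.presheaf.stalk (π x'₁))))).map
        e₁.toRingHom =
      Ideal.span {Ideal.Quotient.mk _ (MvPowerSeries.X 0), Ideal.Quotient.mk _ (MvPowerSeries.X 1),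
        NodeDeformationRing.ofBase _ _
          (AdicCompletion.of (maximalIdeal (Y.presheaf.stalk (f (π x'₁)))) _ (w i₀))})
    (hsing : ¬ IsRegularLocalRing (X'.presheaf.stalk x'₁))
    (hres₁ : ∀ r : X'.presheaf.stalk x'₁, ∃ a : Y.presheaf.stalk (f (π x'₁)),
      r - ((π ≫ f).stalkMap x'₁).hom a ∈ maximalIdeal (X'.presheaf.stalk x'₁))
    (H4 : ringKrullDim (Cpl (X'.presheaf.stalk x'₁)) = (m + 1 : ℕ)) :
    ∃ Ψ : Cpl (X'.presheaf.stalk x'₁) ≃+*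
        NodeDeformationRing (Cpl (Y.presheaf.stalk (f (π x'₁))))
          (AdicCompletion.of (maximalIdeal (Y.presheaf.stalk (f (π x'₁)))) _ (w i₀) ^ (ν i₀ - 2) *
            ∏ i ∈ Finset.univ.erase i₀,
              AdicCompletion.of (maximalIdeal (Y.presheaf.stalk (f (π x'₁)))) _ (w i) ^ ν i),
      ∀ a : Y.presheaf.stalk (f (π x'₁)),
        Ψ (AdicCompletion.of (maximalIdeal (X'.presheaf.stalk x'₁)) (X'.presheaf.stalk x'₁)
            (((π ≫ f).stalkMap x'₁).hom a)) =
          NodeDeformationRing.ofBase _ _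
            (AdicCompletion.of (maximalIdeal (Y.presheaf.stalk (f (π x'₁)))) _ a) := by
  classical
  -- rings
  let A : Type u := Y.presheaf.stalk (f (π x'₁))
  let Λ : Type u := Cpl A
  let O : Type u := X.presheaf.stalk (π x'₁)
  let R : Type u := X'.presheaf.stalk x'₁
  let C : Type u := Cpl R
  haveI : IsNoetherianRing C := isNoetherianRing_adicCompletion_maximalIdeal R
  -- the elements `t̂ᵢ`, the exponent `μ = m_{i₀} ≥ 2`, and the two products
  set th : Fin m → Λ := fun i => AdicCompletion.of (maximalIdeal A) A (w i) with hthdef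
  set μ : ℕ := ν i₀ with hμdef
  set ρ' : Λ := ∏ i ∈ Finset.univ.erase i₀, th i ^ ν i with hρ'def
  have hprod : (∏ i, th i ^ ν i) = th i₀ ^ μ * ρ' := by
    rw [hρ'def, ← Finset.mul_prod_erase Finset.univ (fun i => th i ^ ν i) (Finset.mem_univ i₀)]
  have hth𝔪 : th i₀ ∈ maximalIdeal Λ := by
    have hti : w i₀ ∈ maximalIdeal A := hwm i₀
    show th i₀ ∈ maximalIdeal (AdicCompletion (maximalIdeal A) A)
    rw [AdicCompletion.maximalIdeal_eq_map]
    exact Ideal.mem_map_of_mem _ hti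
  have hh𝔪 : th i₀ ^ μ * ρ' ∈ maximalIdeal Λ :=
    (maximalIdeal Λ).mul_mem_right _ (Ideal.pow_mem_of_mem _ hth𝔪 μ (by omega))
  -- the model `M₀ = Λ⟦u, v⟧/(uv - t̂^μ ρ')` and `e₁' : 𝒪̂_{X,x₁} ≅ M₀` over `Λ`
  let M₀ : Type u := NodeDeformationRing Λ (th i₀ ^ μ * ρ')
  set e₁' : Cpl O ≃+* M₀ := e₁.trans
    (NodeDeformationRing.congr (RingEquiv.refl Λ) (∏ i, th i ^ ν i) (th i₀ ^ μ * ρ') hprod) with he₁'def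
  have he₁'of : ∀ a : A, e₁' (algebraMap O (Cpl O) ((f.stalkMap (π x'₁)).hom a)) =
      NodeDeformationRing.ofBase Λ _ (AdicCompletion.of (maximalIdeal A) A a) := by
    intro a
    rw [he₁'def, RingEquiv.trans_apply, he₁ a, NodeDeformationRing.ofBase_apply,
      NodeDeformationRing.congr_mk_C]
    rfl
  have hΛcentre' : (Pst.map (algebraMap O (Cpl O))).map e₁'.toRingHom =
      Ideal.span ({Ideal.Quotient.mk _ (MvPowerSeries.X 0), Ideal.Quotient.mk _ (MvPowerSeries.X 1),
        NodeDeformationRing.ofBase Λ _ (th i₀)} : Set M₀) := by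
    rw [he₁'def, RingEquiv.toRingHom_trans, ← Ideal.map_map, hΛcentre, Ideal.map_span,
      Set.image_insert_eq, Set.image_insert_eq, Set.image_singleton]
    change Ideal.span {NodeDeformationRing.congr (RingEquiv.refl Λ) (∏ i, th i ^ ν i) (th i₀ ^ μ * ρ') hprod _,
      NodeDeformationRing.congr (RingEquiv.refl Λ) (∏ i, th i ^ ν i) (th i₀ ^ μ * ρ') hprod _,
      NodeDeformationRing.congr (RingEquiv.refl Λ) (∏ i, th i ^ ν i) (th i₀ ^ μ * ρ') hprod _} = _
    rw [NodeDeformationRing.congr_mk_X, NodeDeformationRing.congr_mk_X, NodeDeformationRing.ofBase_apply,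
      NodeDeformationRing.congr_mk_C]
    rfl
  -- ### transfer along the chart, dimension, and the chart computation
  obtain ⟨φ, gM, hφloc, hψloc, hφof, H1, hgM, hgC, h𝔭C, H3⟩ :=
    centreNew_exists_chartMap f PT hπ hPTstalk hh𝔪 e₁' he₁'of hΛcentre' hres₁
  haveI := hφloc
  haveI := hψloc
  have hRC : ¬ IsRegularLocalRing C := by
    intro hC
    haveI := hC
    exact hsing (IsRegularLocalRing.of_flat_of_isLocalHom R C)
  -- a surjection onto `C` from a domain of dimension `≤ m + 1` is an isomorphism; from a regular one, absurd
  have hinj : ∀ {B : Type u} [CommRing B] [IsDomain B] (Θ : B →+* C), Function.Surjective Θ →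
      ringKrullDim B ≤ (m + 1 : ℕ) → Function.Injective Θ := fun Θ hΘs hB =>
    RingHom.injective_of_surjective_of_isDomain_of_ringKrullDim_eq Θ hΘs (m + 1) hB H4
  have hnoreg : ∀ {B : Type u} [CommRing B] [IsRegularLocalRing B] (Θ : B →+* C), Function.Surjective Θ →
      ringKrullDim B ≤ (m + 1 : ℕ) → False := by
    intro B _ _ Θ hΘs hB
    haveI : IsDomain B := isDomain_of_isRegularLocalRing B
    exact hRC (IsRegularLocalRing.of_ringEquiv (RingEquiv.ofBijective Θ ⟨hinj Θ hΘs hB, hΘs⟩))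
  -- the formal models `Λ⟦u, v⟧/(uv - ∏ t̂ᵢ^{m'ᵢ}) ≅ k⟦u, v, T⟧/(uv - ∏ Tᵢ^{νᵢ})` through the Cohen coordinates
  have hmodel : ∀ m' : Fin m → ℕ, ∀ h' : Λ, h' = ∏ i, th i ^ m' i →
      Nonempty (NodeDeformationRing Λ h' ≃+* FormalNodeRing K m m') := by
    intro m' h' hh'
    have hιh' : ι h' = ∏ i, MvPowerSeries.X i ^ m' i := by
      rw [hh', map_prod]
      exact Finset.prod_congr rfl fun i _ => by rw [map_pow, hthdef, hι i]
    exact ⟨(NodeDeformationRing.congr ι h' _ hιh').trans (NodeDeformationRing.toFormalNodeRing K m _)⟩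
  have hdimF : ∀ ν'' : Fin m → ℕ, ringKrullDim (FormalNodeRing K m ν'') ≤ (m + 1 : ℕ) :=
    fun ν'' => FormalNodeRing.ringKrullDim_le K m ν''
  rcases NodeDeformationRing.charts_of_base (Λ := Λ) (C := C) hν2 hth𝔪 φ H1 hgM hgC h𝔭C H3 with
    ⟨q, hq, hPq, a, b, hua, hvb, hab, hnode | ⟨hunit, Θ, hΘs, hΘC⟩⟩ |
    ⟨P, P', q, hUV, hq, hPq, c, hPc, hc𝔪, hP𝔪, Θ, hΘs, hΘψ, hΘu, hΘc⟩
  · -- ### the point `u' = v' = 0` over the centre: `C ≅ Λ⟦u', v'⟧/(u'v' - t̂^{μ-2} ρ')`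
    obtain ⟨ha𝔪, hb𝔪, Θ, hΘs, hΘψ, hΘu, hΘv⟩ := hnode
    -- the exponents `m' = (…, μ - 2, …)`
    set m' : Fin m → ℕ := Function.update ν i₀ (μ - 2) with hm'def
    have hprod' : th i₀ ^ (μ - 2) * ρ' = ∏ i, th i ^ m' i := by
      rw [← Finset.mul_prod_erase Finset.univ (fun i => th i ^ m' i) (Finset.mem_univ i₀), hm'def,
        Function.update_self, hρ'def]
      congr 1
      exact Finset.prod_congr rfl fun i hi => by rw [Function.update_of_ne (Finset.ne_of_mem_erase hi)]
    obtain ⟨eM⟩ := hmodel m' _ hprod'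
    -- some exponent is positive (else `u'v' = 1` with `u' ∈ 𝔪_C`)
    have hm' : ∃ j, m' j ≠ 0 := by
      by_contra hall
      push Not at hall
      have h1 : th i₀ ^ (μ - 2) * ρ' = 1 := by
        rw [hprod']
        refine Finset.prod_eq_one fun i _ => ?_
        rw [hall i, pow_zero]
      have hab1 : a * b = 1 := by rw [hab, h1, map_one, map_one]
      exact ((mem_maximalIdeal _).mp ha𝔪) (IsUnit.of_mul_eq_one b hab1)
    haveI : IsDomain (FormalNodeRing K m m') := FormalNodeRing.isDomain K m hm'
    haveI : IsDomain (NodeDeformationRing Λ (th i₀ ^ (μ - 2) * ρ')) := MulEquiv.isDomain _ eM.toMulEquiv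
    have hdimM : ringKrullDim (NodeDeformationRing Λ (th i₀ ^ (μ - 2) * ρ')) ≤ (m + 1 : ℕ) := by
      rw [ringKrullDim_eq_of_ringEquiv eM]
      exact hdimF _
    have hΘi : Function.Injective Θ := hinj Θ hΘs hdimM
    let Ψ : C ≃+* NodeDeformationRing Λ (th i₀ ^ (μ - 2) * ρ') := (RingEquiv.ofBijective Θ ⟨hΘi, hΘs⟩).symm
    have hΨof : ∀ a : A, Ψ (algebraMap R C (((π ≫ f).stalkMap x'₁).hom a)) =
        NodeDeformationRing.ofBase Λ _ (AdicCompletion.of (maximalIdeal A) A a) := by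
      intro a
      rw [RingEquiv.symm_apply_eq, RingEquiv.ofBijective_apply, ← hφof]
      exact (RingHom.congr_fun hΘψ (AdicCompletion.of (maximalIdeal A) A a)).symm
    exact ⟨Ψ, hΨof⟩
  · -- ### a point of the exceptional conic with `u'` or `v'` a unit: `C ≅ Λ⟦z⟧` is regular
    exfalso
    let eB : MvPowerSeries (Fin 1) Λ ≃+* MvPowerSeries (Fin 1 ⊕ Fin m) K :=
      (MvPowerSeries.mapRingEquiv (σ := Fin 1) ι).trans (MvPowerSeriesNested.nestedEquiv (Fin 1) (Fin m) K).symm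
    haveI : IsRegularLocalRing (MvPowerSeries (Fin 1 ⊕ Fin m) K) :=
      isRegularLocalRing_mvPowerSeries K (Fin 1 ⊕ Fin m)
    refine hnoreg (Θ.comp eB.symm.toRingHom) (hΘs.comp eB.symm.surjective) ?_
    rw [ringKrullDim_mvPowerSeries K (Fin 1 ⊕ Fin m), Nat.card_sum, Nat.card_fin, Nat.card_fin]
    exact le_of_eq (by push_cast; ring)
  · -- ### the origins of the charts "`u ≠ 0`", "`v ≠ 0`": `C ≅ Λ⟦u, t'⟧/(ut' - t̂)` is regular
    exfalso
    have hιt : ι (th i₀) = ∏ i, MvPowerSeries.X i ^ (Pi.single i₀ 1 : Fin m → ℕ) i := by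
      rw [Finset.prod_eq_single i₀ (fun j _ hj => by rw [Pi.single_eq_of_ne hj, pow_zero])
        (fun h => absurd (Finset.mem_univ _) h), Pi.single_eq_same, pow_one, hthdef, hι i₀]
    let eM : NodeDeformationRing Λ (th i₀) ≃+* FormalNodeRing K m (Pi.single i₀ 1) :=
      (NodeDeformationRing.congr ι (th i₀) _ hιt).trans (NodeDeformationRing.toFormalNodeRing K m _)
    haveI : IsRegularLocalRing (FormalNodeRing K m (Pi.single i₀ 1)) :=
      FormalNodeRing.isRegularLocalRing_single K i₀
    refine hnoreg (Θ.comp eM.symm.toRingHom) (hΘs.comp eM.symm.surjective) (hdimF _)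

/-! ## "Clearly, `n_T` has dropped by 2" -/


end Summit.ResolutionOfSingularities.ResolutionOfSingularities.Theorems

end
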